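import Literature.AnabelianGeometry.EtaleTheta.SettingModelCuspProp15Quot
import Literature.AnabelianGeometry.EtaleTheta.SettingModelChiProp15ii
import Literature.AnabelianGeometry.EtaleTheta.Discharge.Sec1Fdd2OfSection
import Literature.AnabelianGeometry.EtaleTheta.SettingModelTateProp15TruthTable
import HarnessLib

/-!
# [EtTh] Prop. 1.5 (i)(ii) — the PLAIN typed predicates `Prop15i` / `Prop15ii` (FACT-LIST F-2502 / F-2503) at the CUSPED
# stage-1 χ-model `modelχ′` (abc-iut-w5-d051's section datum `kummerDataχ′Sec`)

S. Mochizuki, *The étale theta function and its Frobenioid-theoretic manifestations*, Publ. RIMS **45** (2009) [EtTh], §1,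
Prop. 1.5 (i)(ii), PRIMS PDF p. 23 (printed 249) [cite: MochizukiEtTh2009, Prop 1.5 (ii) p.23]. Layer L2 of the abc-iut cell,
seat abc-iut-w6-d076 (gen 5), support file for the row «COUNT-CENSUS EtTh:Prop1.5(i)/(ii)» (abc-iut-L2-lead R1008; census memo
HOME/staging/w6/w6-d076/g5/COUNT-CENSUS-EtTh-Prop15i-ii-w6d076-g5.md §4 (D)).

PROOF-ONLY (0 definitions; nothing restated). abc-iut-L2-t6's `SettingModelCuspProp15Quot` records the «= Ẑ·log» forms
`Prop15iQuot` / `Prop15iiQuot` at the cusped models; the PLAIN structures `Prop15i` (restriction to `Δ_Θ` onto · `log(U) ∈ F¹` ·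
`F² = Kummer classes`) and `Prop15ii` were recorded at `modelχ` (abc-iut-L6-d5 `SettingModelChiProp15ii`) and `modelχq`
(`SettingModelTateProp15(Quot)`) but not at the cusped twin. Since `modelχ′` carries the SAME `Π^tp_X`, theta quotients and
section lemmas as `modelχ` (abc-iut-w5-d029 F5c; abc-iut-w5-d051 `kummerDataχ′Sec` is the `inr`-section datum of abc-iut-w5-d171's
`kummerCoreχ′`), the `modelχ` inputs transport definitionally: the lift of `log(Θ)` (`res_deltaTheta_surjective_gtpY[dd]_modelχ`),
the section bookkeeping (`continuous_inr_modelχ`, `aug_modelχ_inr`, `map_inr_GK[dd]_le_GtpY[dd]_modelχ`), and `log(U) ∈ F¹` /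
`log(Ü) ∈ F̈¹` follow from the Quot forms already proved there (`Prop15iQuot.logU_mem_F1`, `Prop15iiQuot.logUdd_mem_Fdd1`).

* `prop15i_kummerDataχ'Sec`, `prop15ii_kummerDataχ'Sec` — F-2502 / F-2503 as THEOREMS at `modelχ′` for every `Compat` witness;
* `prop15_four_kummerDataχ'Sec` — (i) ∧ (ii) ∧ (iQuot) ∧ (iiQuot) at the cusped section datum;
* `ThetaSetting.exists_isEtThOrigin_and_isCusp_and_prop15i_and_prop15ii` — NV headline: a theta setting of [EtTh] origin WITH A
  CUSP carrying a Kummer datum for which `Prop15i ∧ Prop15ii ∧ Prop15iQuot ∧ Prop15iiQuot` hold at `compat`.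

HONEST FRAMING: SEMI-SYNTHETIC model — consistency / instance evidence for the typed interface ONLY; nothing of [EtTh] is asserted;
a FACT row is an assumption label; typed ≠ proved; no side is taken on [IUTchIII] Cor. 3.12.
-/

noncomputable section

namespace Literature.AnabelianGeometry.EtaleTheta.SettingModel

open Literature.AnabelianGeometry.SemiGraphs _root_.Function

variable (p : ℕ) [Fact p.Prime]

/-- **[EtTh] Prop. 1.5 (ii) (F-2503) at the cusped section datum `kummerDataχ′Sec` of `modelχ′`** — all three typed clauses
(`F̈⁰ ↠ Hom(Δ_Θ, Δ_Θ)`, `log(Ü) ∈ F̈¹`, `F̈² = range kumYdd`), via abc-iut-L2-t10's `KummerCore.prop15ii_of_section` with the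
`modelχ` lift and the Quot form's `log(Ü) ∈ F̈¹`. [cite: MochizukiEtTh2009, Prop 1.5 (ii) p.23] -/
theorem prop15ii_kummerDataχ'Sec (hC : (ThetaSetting.modelχ' p).Compat) :
    ThetaSetting.Prop15ii (kummerDataχ'Sec p) hC :=
  (kummerCoreχ' p).prop15ii_of_section _ (continuous_inr_modelχ p) (aug_modelχ_inr p)
    (map_inr_GK_le_GtpY_modelχ p) (map_inr_GKdd_le_GtpYdd_modelχ p) hC
    (res_deltaTheta_surjective_gtpYdd_modelχ p _) (prop15iiQuot_kummerDataχ'Sec p hC).logUdd_mem_Fdd1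

/-- **[EtTh] Prop. 1.5 (i) (F-2502) at the cusped section datum `kummerDataχ′Sec` of `modelχ′`** — `F⁰ ↠ Hom(Δ_Θ, Δ_Θ)`
(the `modelχ` lift), `log(U) ∈ F¹` (from the Quot form), `F² = range kumY` (OUTRIGHT for section data,
`KummerCore.F2_eq_range_kumY_ofSection`). [cite: MochizukiEtTh2009, Prop 1.5 (i) p.23] -/
theorem prop15i_kummerDataχ'Sec (hC : (ThetaSetting.modelχ' p).Compat) :
    ThetaSetting.Prop15i (kummerDataχ'Sec p) hC :=
  ⟨res_deltaTheta_surjective_gtpY_modelχ p _, (prop15iQuot_kummerDataχ'Sec p hC).logU_mem_F1,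
    (kummerCoreχ' p).F2_eq_range_kumY_ofSection _ (continuous_inr_modelχ p) (aug_modelχ_inr p)
      (map_inr_GK_le_GtpY_modelχ p) (map_inr_GKdd_le_GtpYdd_modelχ p)⟩

/-- **Prop. 1.5 (i) ∧ (ii) ∧ (i)-Quot ∧ (ii)-Quot at the cusped section datum** (every `Compat` witness).
[cite: MochizukiEtTh2009, Prop 1.5 (ii) p.23] -/
theorem prop15_four_kummerDataχ'Sec (hC : (ThetaSetting.modelχ' p).Compat) :
    ThetaSetting.Prop15i (kummerDataχ'Sec p) hC ∧ ThetaSetting.Prop15ii (kummerDataχ'Sec p) hC ∧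
      ThetaSetting.Prop15iQuot (kummerDataχ'Sec p) hC ∧ ThetaSetting.Prop15iiQuot (kummerDataχ'Sec p) hC :=
  ⟨prop15i_kummerDataχ'Sec p hC, prop15ii_kummerDataχ'Sec p hC, prop15iQuot_kummerDataχ'Sec p hC,
    prop15iiQuot_kummerDataχ'Sec p hC⟩

/-- **Census (stage 1 WITH A CUSP), plain + Quot forms**: some theta setting of [EtTh] origin with a cusp carries a Kummer
datum for which `Prop15i`, `Prop15ii`, `Prop15iQuot`, `Prop15iiQuot` ALL hold at `compat` (witness `modelχ′`, `kummerDataχ′Sec`).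
[cite: MochizukiEtTh2009, Prop 1.5 (ii) p.23] -/
theorem _root_.Literature.AnabelianGeometry.EtaleTheta.ThetaSetting.exists_isEtThOrigin_and_isCusp_and_prop15i_and_prop15ii :
    ∃ D : ThetaSetting p, D.IsEtThOrigin ∧ (∃ x : D.Pt, D.IsCusp x) ∧ ∃ E : D.KummerData,
      ThetaSetting.Prop15i E D.compat ∧ ThetaSetting.Prop15ii E D.compat ∧
        ThetaSetting.Prop15iQuot E D.compat ∧ ThetaSetting.Prop15iiQuot E D.compat :=
  ⟨ThetaSetting.modelχ' p, ThetaSetting.modelχ'_isEtThOrigin p, exists_isCusp_modelχ' p, kummerDataχ'Sec p,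
    prop15_four_kummerDataχ'Sec p _⟩

/-! ### Stage 2 with a cusp: `modelχq′ p i j` (appended, v2) -/

section stage2

variable (i j : ℤ) (hj : Even j)

/-- `Compat` of the cusped stage-2 model from `Compat` of `modelχq` — the three fields are statements about the shared carriers.
[cite: MochizukiEtTh2009, Prop 1.5 p.22] -/
theorem compat_modelχq'_of_compat_modelχq (hC : (ThetaSetting.modelχq p i j hj).Compat) :
    (ThetaSetting.modelχq' p i j hj).Compat :=
  ⟨hC.deltaTheta_le_DtpYTheta, hC.deltaTheta_le_DtpYddTheta, hC.GKdd_normal⟩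

/-- … and conversely. [cite: MochizukiEtTh2009, Prop 1.5 p.22] -/
theorem compat_modelχq_of_compat_modelχq' (hC : (ThetaSetting.modelχq' p i j hj).Compat) :
    (ThetaSetting.modelχq p i j hj).Compat :=
  ⟨hC.deltaTheta_le_DtpYTheta, hC.deltaTheta_le_DtpYddTheta, hC.GKdd_normal⟩

/-- **[EtTh] Prop. 1.5 (i) ∧ (ii) (F-2502 ∧ F-2503) at the `inr`-section Kummer datum of the CUSPED stage-2 core `kummerCoreχq′`**
(every `i`, every even `j`, every `Compat` witness): the `modelχq` kit route of abc-iut-L2-t6 / abc-iut-L6-d5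
(`prop15_i_ii_ofKit_inrSection_modelχq`: kit `yCoordKitχq′` = `yCoordKitχq` field by field, lift `zClassYχq`, section lemmas
`map_inr_GK[dd]_le_GtpY[dd]_modelχq'`) transports definitionally to the cusped twin. [cite: MochizukiEtTh2009, Prop 1.5 (ii) p.23] -/
theorem prop15_i_ii_inrSection_modelχq' (hC : (ThetaSetting.modelχq' p i j hj).Compat) :
    ThetaSetting.Prop15i ((kummerCoreχq' p i j hj).toKummerDataOfSection SemidirectProduct.inr (continuous_inrχq p i j)
        (fun _ => rfl) (map_inr_GK_le_GtpY_modelχq' p i j hj) (map_inr_GKdd_le_GtpYdd_modelχq' p i j hj)) hC ∧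
      ThetaSetting.Prop15ii ((kummerCoreχq' p i j hj).toKummerDataOfSection SemidirectProduct.inr (continuous_inrχq p i j)
        (fun _ => rfl) (map_inr_GK_le_GtpY_modelχq' p i j hj) (map_inr_GKdd_le_GtpYdd_modelχq' p i j hj)) hC :=
  haveI : T2Space (ThetaSetting.modelχq' p i j hj).GtpTheta := CurveTheta.t2Space_GTheta (curveχq p i j)
  (kummerCoreχq' p i j hj).prop15i_and_prop15ii_ofSection_of_kit (yCoordKitχq' p i j hj) _ (continuous_inrχq p i j)
    (fun _ => rfl) (map_inr_GK_le_GtpY_modelχq' p i j hj) (map_inr_GKdd_le_GtpYdd_modelχq' p i j hj) hC rfl rfl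
    (fun _ hd => yThetaχq_eq_one_of_mem_deltaTheta p i j hd) (zClassYχq p i j hj)
    (res_zClassYχq_eq_logTheta p i j hj (compat_modelχq_of_compat_modelχq' p i j hj hC))

include i j hj in
/-- **Census (stage 2 WITH A CUSP), plain forms**: some Tate-sheared theta setting of [EtTh] origin with a cusp carries a Kummer datum for
which `Prop15i ∧ Prop15ii` hold at `compat` (witness `modelχq′`, the `inr`-section datum of `kummerCoreχq′`).
[cite: MochizukiEtTh2009, Prop 1.5 (ii) p.23] -/
theorem _root_.Literature.AnabelianGeometry.EtaleTheta.ThetaSetting.exists_isEtThOrigin_and_isCusp_and_prop15i_and_prop15ii_stage2 :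
    ∃ D : ThetaSetting p, D.IsEtThOrigin ∧ (∃ x : D.Pt, D.IsCusp x) ∧ ∃ E : D.KummerData,
      ThetaSetting.Prop15i E D.compat ∧ ThetaSetting.Prop15ii E D.compat :=
  ⟨ThetaSetting.modelχq' p i j hj, ThetaSetting.modelχq'_isEtThOrigin p i j hj, exists_isCusp_modelχq' p i j hj, _,
    prop15_i_ii_inrSection_modelχq' p i j hj _⟩

end stage2

end Literature.AnabelianGeometry.EtaleTheta.SettingModel

end
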